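import Literature.Probability.LatticeModels.OnsagerYang
import Literature.Probability.LatticeModels.IsingTransport
import HarnessLib

/-!
# Translation invariance of the free and plus states on spin products

Trunk G02 (T-STATMECH), topic `Probability/LatticeModels`, namespace `Literature.StatMech`. For the
nearest-neighbour Ising model on `ℤ^d`, `β, h ≥ 0`, the infinite-volume correlations of the tree
(`plusCorr d β h A = lim_L ⟨σ_A⟩⁺_{Λ(L);β,h}`, `freeCorr d β h A = lim_L ⟨σ_A⟩^∅_{Λ(L);β,h}`,
`IsingThermodynamics.lean`, limits along the **centred** boxes) are invariant under lattice
translations: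

`⟨σ_{A+v}⟩⁺_{β,h} = ⟨σ_A⟩⁺_{β,h}`, `⟨σ_{A+v}⟩^∅_{β,h} = ⟨σ_A⟩^∅_{β,h}` (`plusCorr_shift`, `freeCorr_shift`),

as in

* S. Friedli, Y. Velenik, *Statistical Mechanics of Lattice Systems*, CUP 2017, Thm. 3.17 (2):
  "`⟨·⟩⁺_{β,h}` and `⟨·⟩⁻_{β,h}` are translation invariant" (proof, p. 105: `⟨σ_i⟩⁺_{i+B(k)} =
  ⟨σ_0⟩⁺_{B(k)}` and the limit along any sequence `Λ_n ↑ ℤ^d`), and Exercise 3.16 for the free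
  state.

This is the input of the translation invariance (R2 of ADS15 Thm. 2.3) of the infinite-volume
random currents (`DoubleCurrentsShift.lean`), whose limit laws are built from `plusCorr`/`freeCorr`
(`CurrentsEdgeAvoidance.lean`).

## Proof

Transport along the translation (`isingCorr_plus_map_shift` of `OnsagerYang.lean`;
`isingCorr_free_map` of `IsingTransport.lean`): `⟨σ_{A+v}⟩_{Λ(L)+v} = ⟨σ_A⟩_{Λ(L)}`; and the
translated boxes are sandwiched between centred ones, `Λ(L-M)+v ⊆ Λ(L) ⊆ Λ(L+M)+v` for
`M = ‖v‖_∞` (`map_shift_box_subset`, `box_subset_map_shift_box` of `PlusStateFKG.lean`), so by the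
volume monotonicity of the correlations (GKS, `isingCorr_plus_le_of_subset`,
`isingCorr_free_le_of_subset`) the sequence `⟨σ_{A+v}⟩_{Λ(L)}` is squeezed between two sequences
converging to `⟨σ_A⟩`.

## Mathlib status

Anchors: `Filter.Tendsto.squeeze'`, `Filter.tendsto_add_atTop_iff_nat`, `Filter.tendsto_sub_atTop_nat`,
`tendsto_nhds_unique`; tree: `isingCorr_plus_map_shift` (`OnsagerYang.lean`), `isingCorr_free_map`
(`IsingTransport.lean`), `map_shift_box_subset`, `box_subset_map_shift_box` (`PlusStateFKG.lean`),
`isingCorr_plus_le_of_subset`, `isingCorr_free_le_of_subset`, `hasBoxLimit_isingCorr_plus_holds`,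
`hasBoxLimit_isingCorr_free_holds` (`GKSInequalities.lean`).
-/

noncomputable section

open MeasureTheory Filter Topology Finset Literature.Probability.LatticeModels Literature.Probability.Percolation

namespace Literature.Probability.LatticeModels

variable (d : ℕ)

/-! ### Transport of free correlations -/

/-- **Transport of free correlations along a translation**: `⟨σ_{A+v}⟩^∅_{Λ+v;β,h} = ⟨σ_A⟩^∅_{Λ;β,h}`. [cite: FriedliVelenik2017, Exercise 3.14, p. 115] -/
theorem isingCorr_free_map_shift (v : Site d) (Λ : Finset (Site d)) (β h : ℝ) (A : Finset (Site d)) :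
    isingCorr (zdGraph d) (Λ.map (Site.shift v).toEmbedding) β h .free (A.map (Site.shift v).toEmbedding) =
      isingCorr (zdGraph d) Λ β h .free A :=
  isingCorr_free_map (G := zdGraph d) (G' := zdGraph d) (Site.shift v).toEmbedding
    (fun x _ y _ => zdGraph_adj_shift_iff v x y) β h A

/-! ### Translation invariance of the infinite-volume correlations -/

/-- **Translation invariance of the plus state on spin products** (Friedli–Velenik 2017,
Thm. 3.17 (2)): for `β, h ≥ 0`, `⟨σ_{A+v}⟩⁺_{β,h} = ⟨σ_A⟩⁺_{β,h}`. The centred-box limit defining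
`plusCorr (A+v)` is squeezed between `⟨σ_{A+v}⟩⁺_{Λ(L±M)+v} = ⟨σ_A⟩⁺_{Λ(L±M)} → ⟨σ_A⟩⁺`. [cite: FriedliVelenik2017, Thm. 3.17] -/
theorem plusCorr_shift {β h : ℝ} (hβ : 0 ≤ β) (hh : 0 ≤ h) (v : Site d) (A : Finset (Site d)) :
    plusCorr d β h (A.map (Site.shift v).toEmbedding) = plusCorr d β h A := by
  set A' := A.map (Site.shift v).toEmbedding with hA'
  set M := Site.supNorm v with hM
  obtain ⟨L₁, hL₁⟩ := exists_forall_subset_box d A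
  -- the sequence defining `plusCorr A'` and its two squeezing sequences
  have hmain : Tendsto (fun L : ℕ => isingCorr (zdGraph d) (box d L) β h .plus A') atTop (𝓝 (plusCorr d β h A')) :=
    hasBoxLimit_isingCorr_plus_holds hβ hh A'
  have hlow : Tendsto (fun L : ℕ => isingCorr (zdGraph d) (box d (L + M)) β h .plus A) atTop (𝓝 (plusCorr d β h A)) :=
    (tendsto_add_atTop_iff_nat M).2 (hasBoxLimit_isingCorr_plus_holds hβ hh A)
  have hup : Tendsto (fun L : ℕ => isingCorr (zdGraph d) (box d (L - M)) β h .plus A) atTop (𝓝 (plusCorr d β h A)) :=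
    (hasBoxLimit_isingCorr_plus_holds hβ hh A).comp (tendsto_sub_atTop_nat M)
  have hsq : Tendsto (fun L : ℕ => isingCorr (zdGraph d) (box d L) β h .plus A') atTop (𝓝 (plusCorr d β h A)) := by
    refine hlow.squeeze' hup ?_ ?_
    · -- `Λ(L) ⊆ Λ(L+M)+v`, so `⟨σ_{A'}⟩⁺_{Λ(L+M)+v} ≤ ⟨σ_{A'}⟩⁺_{Λ(L)}`
      filter_upwards [eventually_ge_atTop (L₁ + M)] with L hL
      rw [← isingCorr_plus_map_shift v (box d (L + M)) A β h]
      refine isingCorr_plus_le_of_subset (zdGraph d) hβ hh ?_ (box_subset_map_shift_box L v)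
      -- `A' ⊆ Λ(L)`
      have hA1 : A ⊆ box d (L - M) := hL₁ _ (by omega)
      have : A' ⊆ (box d (L - M)).map (Site.shift v).toEmbedding := Finset.map_subset_map.2 hA1
      refine this.trans ?_
      have h := map_shift_box_subset (L - M) v
      rwa [Nat.sub_add_cancel (by omega)] at h
    · -- `Λ(L-M)+v ⊆ Λ(L)`, so `⟨σ_{A'}⟩⁺_{Λ(L)} ≤ ⟨σ_{A'}⟩⁺_{Λ(L-M)+v}`
      filter_upwards [eventually_ge_atTop (L₁ + M)] with L hL
      rw [← isingCorr_plus_map_shift v (box d (L - M)) A β h]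
      refine isingCorr_plus_le_of_subset (zdGraph d) hβ hh (Finset.map_subset_map.2 (hL₁ _ (by omega))) ?_
      have h := map_shift_box_subset (L - M) v
      rwa [Nat.sub_add_cancel (by omega)] at h
  exact tendsto_nhds_unique hmain hsq

/-- **Translation invariance of the free state on spin products** (Friedli–Velenik 2017,
Exercise 3.16 with Thm. 3.17 (2)): for `β, h ≥ 0`, `⟨σ_{A+v}⟩^∅_{β,h} = ⟨σ_A⟩^∅_{β,h}` (same squeeze,
with the opposite volume monotonicity of the free correlations). [cite: FriedliVelenik2017, Exercise 3.16, p. 115] -/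
theorem freeCorr_shift {β h : ℝ} (hβ : 0 ≤ β) (hh : 0 ≤ h) (v : Site d) (A : Finset (Site d)) :
    freeCorr d β h (A.map (Site.shift v).toEmbedding) = freeCorr d β h A := by
  set A' := A.map (Site.shift v).toEmbedding with hA'
  set M := Site.supNorm v with hM
  obtain ⟨L₁, hL₁⟩ := exists_forall_subset_box d A
  have hmain : Tendsto (fun L : ℕ => isingCorr (zdGraph d) (box d L) β h .free A') atTop (𝓝 (freeCorr d β h A')) :=
    hasBoxLimit_isingCorr_free_holds hβ hh A'
  have hup : Tendsto (fun L : ℕ => isingCorr (zdGraph d) (box d (L + M)) β h .free A) atTop (𝓝 (freeCorr d β h A)) :=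
    (tendsto_add_atTop_iff_nat M).2 (hasBoxLimit_isingCorr_free_holds hβ hh A)
  have hlow : Tendsto (fun L : ℕ => isingCorr (zdGraph d) (box d (L - M)) β h .free A) atTop (𝓝 (freeCorr d β h A)) :=
    (hasBoxLimit_isingCorr_free_holds hβ hh A).comp (tendsto_sub_atTop_nat M)
  have hsq : Tendsto (fun L : ℕ => isingCorr (zdGraph d) (box d L) β h .free A') atTop (𝓝 (freeCorr d β h A)) := by
    refine hlow.squeeze' hup ?_ ?_
    · -- `Λ(L-M)+v ⊆ Λ(L)`, so `⟨σ_{A'}⟩^∅_{Λ(L-M)+v} ≤ ⟨σ_{A'}⟩^∅_{Λ(L)}`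
      filter_upwards [eventually_ge_atTop (L₁ + M)] with L hL
      rw [← isingCorr_free_map_shift d v (box d (L - M)) β h A]
      refine isingCorr_free_le_of_subset (zdGraph d) hβ hh (Finset.map_subset_map.2 (hL₁ _ (by omega))) ?_
      have h := map_shift_box_subset (L - M) v
      rwa [Nat.sub_add_cancel (by omega)] at h
    · -- `Λ(L) ⊆ Λ(L+M)+v`, so `⟨σ_{A'}⟩^∅_{Λ(L)} ≤ ⟨σ_{A'}⟩^∅_{Λ(L+M)+v}`
      filter_upwards [eventually_ge_atTop (L₁ + M)] with L hL
      rw [← isingCorr_free_map_shift d v (box d (L + M)) β h A]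
      refine isingCorr_free_le_of_subset (zdGraph d) hβ hh ?_ (box_subset_map_shift_box L v)
      have hA1 : A ⊆ box d (L - M) := hL₁ _ (by omega)
      have : A' ⊆ (box d (L - M)).map (Site.shift v).toEmbedding := Finset.map_subset_map.2 hA1
      refine this.trans ?_
      have h := map_shift_box_subset (L - M) v
      rwa [Nat.sub_add_cancel (by omega)] at h
  exact tendsto_nhds_unique hmain hsq

end Literature.Probability.LatticeModels
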